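import Summits.Langlands.Langlands.Theses.StickelbergerDial
import Literature.NumberTheory.Automorphic.Qian2022PotentialAutomorphy

/-!
# Sketch — first lemmas of the crux ideas for `StickelbergerDial.SectorComplement`
(crux stmt-Langlands-17964, crux-ideate round 1, ideator k = 2)

Nothing here is proved; every `theorem` is a `sorry`d SIGNATURE that must elaborate.
`X` below is the route target `WeightZeroNonOrdinaryPA` (the hypothesis of the junction).

* Card A `tensor-tiling`      : `stub_tiling_two`, `PotentialAutomorphyAPWeight`, `stub_tile_AP`.
* Card B `anchor-prime-descent`: `CompanionsOnWeightZeroSector`, `AnchorPrimeExists`,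
                                 `AutomorphyOnWeightZeroSector`, `stub_companions`, `stub_anchor_descent`.
* Card C `summand-transport`  : `SummandsPAWeightZero`, `stub_summandsPA`.
-/

namespace Summit.Langlands.Langlands.Cruxes.SectorComplement.Ideas17964

open scoped BigOperators Classical Matrix TensorProduct
open Filter Set Function
open Summit.Langlands Summit.Langlands.Langlands.Theses.StickelbergerDial
open Literature.NumberTheory.Automorphic Literature.NumberTheory.GaloisRepresentations

/-! ## Card A — tensor tiling -/

/-- de Bruijn complement of the weight set `{0, m}` inside `[0, 2me)`: the blocks
`[2mk, 2mk + m)`, `k < e` (the infinity type, above one embedding of `K`, of the auxiliary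
algebraic Hecke character `θ` of the cyclic CM extension `L/K` of degree `d = me`). -/
def twoBlock (m e : ℕ) : Finset ℕ :=
  (Finset.range e).biUnion fun k => (Finset.range m).image fun j => 2 * m * k + j

/-- TILING LEMMA (rank 2): `{0, m} ⊕ twoBlock m e = [0, 2me)` — the labelled Hodge–Tate weights of
`r ⊗ Ind_L^K θ` are CONSECUTIVE when `HT_σ(r) = {0, m}` and `θ` has infinity type `twoBlock m e`
above `σ`; the sum is direct (cardinalities multiply), so the tensor product stays regular. -/
theorem stub_tiling_two (m e : ℕ) (hm : 0 < m) (he : 0 < e) :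
    Finset.image₂ (· + ·) ({0, m} : Finset ℕ) (twoBlock m e) = Finset.range (2 * m * e) ∧
      (twoBlock m e).card = m * e := by
  sorry

/-- Sanity instance of the tiling lemma (`m = 3`, `e = 2`: `{0,3} ⊕ {0,1,2,6,7,8} = [0,12)`). -/
example : Finset.image₂ (· + ·) ({0, 3} : Finset ℕ) (twoBlock 3 2) = Finset.range 12 := by decide

/-- A non-tileable rank-3 weight set: no `B` with `{0,1,3} ⊕ B` an initial interval of length 6
(the smallest candidate); de Bruijn: a 3-set tiles an interval iff it is an arithmetic
progression.  (Decidable finite check; the general statement is de Bruijn 1956.) -/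
example : ∀ B ∈ (Finset.range 6).powerset, B.card = 2 →
    Finset.image₂ (· + ·) ({0, 1, 3} : Finset ℕ) B ≠ Finset.range 6 := by decide

/-- POTENTIAL AUTOMORPHY IN ARITHMETIC-PROGRESSION WEIGHT `g·{0,…,n-1}` over CM fields at an
unramified prime — the rank-`n`, `d = g` instance of the tiling dial (`B = [0, g)`): `X` with the
weight clause `{0,…,n-1}` replaced by `{0, g, …, (n-1)g}` and `ℓ > (ng)²`, conclusion in Qian's
form (regular algebraic cuspidal over a CM Galois `K'/K` linearly disjoint from `K^av`).  The
residual hypotheses are those of `X` on `τ` (the line must upgrade them to `τ ⊗ Ind θ̄`,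
imprimitive-bigness lemma). -/
def PotentialAutomorphyAPWeight (g : ℕ) : Prop :=
  ∀ (K : Type) [Field K] [NumberField K], NumberField.IsCMField K →
    ∀ (Kav : Type) [Field Kav] [Algebra K Kav], FiniteDimensional K Kav →
    ∀ (n : ℕ), 2 ≤ n → ∀ (ℓ : ℕ) [Fact ℓ.Prime], (n * g) ^ 2 < ℓ → 2 * (n * g) < ℓ →
    Algebra.IsUnramifiedIn (NumberField.RingOfIntegers K) (Ideal.span {(ℓ : ℤ)}) →
    ∀ (ι : PadicAlgCl ℓ ≃+* ℂ) (r : FramedGaloisRep K (PadicAlgCl ℓ) n)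
      (τ : Field.absoluteGaloisGroup K →* GL (Fin n) (padicAlgClResidueField ℓ)),
      (∀ᶠ v in cofinite, r.IsUnramifiedAt v) →
      (∀ (v : IsDedekindDomain.HeightOneSpectrum (NumberField.RingOfIntegers K))
          (hv : ((ℓ : ℕ) : NumberField.RingOfIntegers K) ∈ v.asIdeal),
          let D := Literature.NumberTheory.PAdicHodge.fontainePstAdicCompletion v ℓ hv
          D.IsCrystallineFramed (r.toLocal v) ∧
            (letI := D.algebra
             ∀ τ' : v.adicCompletion K →ₐ[ℚ_[ℓ]] PadicAlgCl ℓ,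
               r.labelledHodgeTateWeightsAt v D.algebra D.𝔅 τ'.toRingHom =
                 (Multiset.range n).map fun i : ℕ => ((g * i : ℕ) : ℤ))) →
      r.IsResidualRepOf (RingHom.id _) τ → IsAbsIrreducible τ → IsDecomposedGeneric τ →
      IsAbsIrreducible (τ.comp (absGaloisGroupAdjoinRootsOfUnity K ℓ).subtype) →
      Subgroup.IsEnormous ((absGaloisGroupAdjoinRootsOfUnity K ℓ).map τ) →
      (∃ σ : Field.absoluteGaloisGroup K, σ ∉ absGaloisGroupAdjoinRootsOfUnity K ℓ ∧
          ∃ c : padicAlgClResidueField ℓ, (τ σ).1 = c • 1) →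
      ∃ (K' : Type) (_ : Field K') (_ : NumberField K') (_ : Algebra K K'),
        IsGalois K K' ∧ NumberField.IsCMField K' ∧ IsField (TensorProduct K Kav K') ∧
          Algebra.IsUnramifiedIn (NumberField.RingOfIntegers K') (Ideal.span {(ℓ : ℤ)}) ∧
          Qian2022.IsAutomorphic ι (r.restrictField K')

/-- Card A, FIRST LEMMA (the tiling dial, `d = g`): `X ⇒` potential automorphy in every
arithmetic-progression weight.  Mechanism: apply `X` to `r ⊗ Ind_L^K θ` (`[L:K] = g` cyclic CM,
`θ` of infinity type `[0, g)` above each embedding), then untwist by cyclic base change. -/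
theorem stub_tile_AP (hX : WeightZeroNonOrdinaryPA) : ∀ g : ℕ, 0 < g → PotentialAutomorphyAPWeight g := by
  sorry

/-! ## Card B — anchor-prime descent inside the `X`-built compatible system -/

/-- The hypotheses of `X` on `(K, Kav, n, ℓ, ι, r, τ)`, bundled (verbatim the binders of
`WeightZeroNonOrdinaryPA`). -/
def XHyp (K : Type) [Field K] [NumberField K] (n ℓ : ℕ) [Fact ℓ.Prime]
    (r : FramedGaloisRep K (PadicAlgCl ℓ) n)
    (τ : Field.absoluteGaloisGroup K →* GL (Fin n) (padicAlgClResidueField ℓ)) : Prop :=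
  NumberField.IsCMField K ∧ 2 ≤ n ∧ n ^ 2 < ℓ ∧ 2 * n < ℓ ∧
    Algebra.IsUnramifiedIn (NumberField.RingOfIntegers K) (Ideal.span {(ℓ : ℤ)}) ∧
    (∀ᶠ v in cofinite, r.IsUnramifiedAt v) ∧
    (∀ (v : IsDedekindDomain.HeightOneSpectrum (NumberField.RingOfIntegers K))
        (hv : ((ℓ : ℕ) : NumberField.RingOfIntegers K) ∈ v.asIdeal),
        let D := Literature.NumberTheory.PAdicHodge.fontainePstAdicCompletion v ℓ hv
        D.IsCrystallineFramed (r.toLocal v) ∧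
          (letI := D.algebra
           ∀ τ' : v.adicCompletion K →ₐ[ℚ_[ℓ]] PadicAlgCl ℓ,
             r.labelledHodgeTateWeightsAt v D.algebra D.𝔅 τ'.toRingHom =
               (Multiset.range n).map fun i : ℕ => (i : ℤ))) ∧
    r.IsResidualRepOf (RingHom.id _) τ ∧ IsAbsIrreducible τ ∧ IsDecomposedGeneric τ ∧
    IsAbsIrreducible (τ.comp (absGaloisGroupAdjoinRootsOfUnity K ℓ).subtype) ∧
    Subgroup.IsEnormous ((absGaloisGroupAdjoinRootsOfUnity K ℓ).map τ) ∧
    ∃ σ : Field.absoluteGaloisGroup K, σ ∉ absGaloisGroupAdjoinRootsOfUnity K ℓ ∧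
      ∃ c : padicAlgClResidueField ℓ, (τ σ).1 = c • 1

/-- COMPANIONS ON THE WEIGHT-ZERO SECTOR: every `r` in `X`'s sector sits in a compatible family —
for every `(ℓ', ι')` there is an `ℓ'`-adic `r'` over `K` ITSELF with the same Satake avatar
(common `α : Multiset ℂ` read through `ι` and `ι'`) at almost all places.  From `X`: Brauer–Taylor
virtual decomposition over the intermediate fields `E ⊆ K'` with `K'/E` soluble, ACC+ Prop. 6.5.13
soluble descent, HLTT Galois representations over each `E`, Brauer character identity
(BLGGT Thm 5.5.1 pattern, non-polarizable). -/
def CompanionsOnWeightZeroSector : Prop :=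
  ∀ (K : Type) [Field K] [NumberField K] (n ℓ : ℕ) [Fact ℓ.Prime] (ι : PadicAlgCl ℓ ≃+* ℂ)
    (r : FramedGaloisRep K (PadicAlgCl ℓ) n)
    (τ : Field.absoluteGaloisGroup K →* GL (Fin n) (padicAlgClResidueField ℓ)),
    XHyp K n ℓ r τ →
    ∀ (ℓ' : ℕ) [Fact ℓ'.Prime] (ι' : PadicAlgCl ℓ' ≃+* ℂ),
      ∃ r' : FramedGaloisRep K (PadicAlgCl ℓ') n,
        ∀ᶠ v : IsDedekindDomain.HeightOneSpectrum (NumberField.RingOfIntegers K) in cofinite,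
          ∃ α : Multiset ℂ, r.IsUnramifiedAt v ∧ r'.IsUnramifiedAt v ∧
            r.HasFrobCharpolyAt v (arithFrobPolyOfSatake ι v.residueCard n α) ∧
            r'.HasFrobCharpolyAt v (arithFrobPolyOfSatake ι' v.residueCard n α)

/-- AUTOMORPHY (over `K` itself, not potential) on `X`'s sector, in Qian's form. -/
def AutomorphyOnWeightZeroSector : Prop :=
  ∀ (K : Type) [Field K] [NumberField K] (n ℓ : ℕ) [Fact ℓ.Prime] (ι : PadicAlgCl ℓ ≃+* ℂ)
    (r : FramedGaloisRep K (PadicAlgCl ℓ) n)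
    (τ : Field.absoluteGaloisGroup K →* GL (Fin n) (padicAlgClResidueField ℓ)),
    XHyp K n ℓ r τ → Qian2022.IsAutomorphic ι r

/-- ANCHOR PRIME EXISTS (the crux of Card B): for `r` in `X`'s sector there is an ADMISSIBLE prime
`ℓ'` (unramified in `K`, `ℓ' > n²`) and an `ℓ'`-adic companion `r'` of `r` over `K` which again
satisfies `X`'s analytic and residual hypotheses at `ℓ'` for a residual representation `τ'` that is
RESIDUALLY AUTOMORPHIC OVER `K` IN WEIGHT ZERO IN CHARACTERISTIC 0: a weight-0 cuspidal `π` of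
`GL_n(𝔸_K)` unramified above `ℓ'` and a framed `r₀` with HLTT's property of `r_{ι'}(π)` whose
residual representation is `τ'` (menu of anchors: CM automorphic induction, base change of a
Serre-modular odd representation of `Γ_{K⁺}`, functorial images, Dieulefait chains). -/
def AnchorPrimeExists : Prop :=
  ∀ (K : Type) [Field K] [NumberField K] (n ℓ : ℕ) [Fact ℓ.Prime] (ι : PadicAlgCl ℓ ≃+* ℂ)
    (r : FramedGaloisRep K (PadicAlgCl ℓ) n)
    (τ : Field.absoluteGaloisGroup K →* GL (Fin n) (padicAlgClResidueField ℓ)),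
    XHyp K n ℓ r τ →
    ∃ (ℓ' : ℕ) (_ : Fact ℓ'.Prime) (ι' : PadicAlgCl ℓ' ≃+* ℂ) (r' : FramedGaloisRep K (PadicAlgCl ℓ') n)
      (τ' : Field.absoluteGaloisGroup K →* GL (Fin n) (padicAlgClResidueField ℓ'))
      (hcpt : isCompact_glFiniteIntegralLevel n K) (π : CuspidalAutomorphicRepData n K hcpt)
      (r₀ : FramedGaloisRep K (PadicAlgCl ℓ') n),
      (∀ᶠ v : IsDedekindDomain.HeightOneSpectrum (NumberField.RingOfIntegers K) in cofinite,
          ∃ α : Multiset ℂ, r.IsUnramifiedAt v ∧ r'.IsUnramifiedAt v ∧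
            r.HasFrobCharpolyAt v (arithFrobPolyOfSatake ι v.residueCard n α) ∧
            r'.HasFrobCharpolyAt v (arithFrobPolyOfSatake ι' v.residueCard n α)) ∧
      XHyp K n ℓ' r' τ' ∧ π.1.HasWeightZero ∧
      (∀ q : ℕ, q.Prime → q ≠ ℓ' →
        (∀ w : IsDedekindDomain.HeightOneSpectrum (NumberField.RingOfIntegers K),
            ((q : ℕ) : NumberField.RingOfIntegers K) ∈ w.asIdeal → π.1.IsUnramifiedAt w) →
        ∀ v : IsDedekindDomain.HeightOneSpectrum (NumberField.RingOfIntegers K),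
          ((q : ℕ) : NumberField.RingOfIntegers K) ∈ v.asIdeal → ∀ α : Multiset ℂ,
            π.1.HasSatakeParamAt v α → r₀.IsUnramifiedAt v ∧
              r₀.HasFrobCharpolyAt v (arithFrobPolyOfSatake ι' v.residueCard n α)) ∧
      r₀.IsResidualRepOf (RingHom.id _) τ' ∧
      ∀ w : IsDedekindDomain.HeightOneSpectrum (NumberField.RingOfIntegers K),
        ((ℓ' : ℕ) : NumberField.RingOfIntegers K) ∈ w.asIdeal → π.1.IsUnramifiedAt w

/-- Card B, FIRST LEMMA: `X ⇒` companions on the sector. -/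
theorem stub_companions (hX : WeightZeroNonOrdinaryPA) : CompanionsOnWeightZeroSector := by
  sorry

/-- Card B, COMPOSITION ("one anchor prime suffices"): companions + ACC+ 6.1.1 (the route's own
support item) + an anchor prime ⇒ automorphy over `K` on the sector (automorphy of `r'` at `ℓ'`
by lifting, transported back to `r` along the common Satake avatar by Chebotarev + Brauer–Nesbitt
+ HLTT).  This is the DESCENT `K' → K` component of the junction, without insoluble base change. -/
theorem stub_anchor_descent (hC : CompanionsOnWeightZeroSector) (hF : FLLiftingWeightZero)
    (hA : AnchorPrimeExists) : AutomorphyOnWeightZeroSector := by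
  sorry

/-! ## Card C — summand transport (irreducibility clause of (A) on weight 0, no ordinary prime) -/

/-- SUMMANDS OF A WEIGHT-ZERO AVATAR ARE STRONGLY POTENTIALLY AUTOMORPHIC at every admissible
prime: `OrdinaryPrimeTransport.SummandsPotentiallyAutomorphic` with the ordinary prime `(ℓ₀, ρ₁)`
replaced by "`π` has weight zero, `ℓ₀ > p²` unramified in `K`, `π` unramified above `ℓ₀`" and with
`X`'s residual hypotheses on the summand `σ` (rank `k ≥ 2`; rank-1 summands are Hecke characters).
Mechanism: the summand's labelled weights form a `k`-subset of `{0,…,p-1}`; for `k = 2` (all that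
occurs when `p = 3`) it is `{a, a+m}`, tileable, so Card A's dial + `X` apply to `σ`. -/
def SummandsPAWeightZero : Prop :=
  ∀ (K : Type) [Field K] [NumberField K], NumberField.IsCMField K → ∀ (p : ℕ), Nat.Prime p → 3 ≤ p →
    ∀ (hcpt : isCompact_glFiniteIntegralLevel p K) (π : CuspidalAutomorphicRepData p K hcpt),
      π.1.HasWeightZero → ∀ (ℓ₀ : ℕ) [Fact ℓ₀.Prime] (ι₀ : PadicAlgCl ℓ₀ ≃+* ℂ), p ^ 2 < ℓ₀ → 2 * p < ℓ₀ →
      Algebra.IsUnramifiedIn (NumberField.RingOfIntegers K) (Ideal.span {(ℓ₀ : ℤ)}) →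
      (∀ w : IsDedekindDomain.HeightOneSpectrum (NumberField.RingOfIntegers K),
          ((ℓ₀ : ℕ) : NumberField.RingOfIntegers K) ∈ w.asIdeal → π.1.IsUnramifiedAt w) →
      ∀ (ρ₀ : FramedGaloisRep K (PadicAlgCl ℓ₀) p),
        (∀ᶠ v : IsDedekindDomain.HeightOneSpectrum (NumberField.RingOfIntegers K) in cofinite,
            SatakeFrobCompatibleAt ι₀ π.1 ρ₀ v) →
        ∀ (k : ℕ), 2 ≤ k → k < p → ∀ (σ : FramedGaloisRep K (PadicAlgCl ℓ₀) k)
          (ν : FramedGaloisRep K (PadicAlgCl ℓ₀) (p - k))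
          (τ : Field.absoluteGaloisGroup K →* GL (Fin k) (padicAlgClResidueField ℓ₀)),
          (∀ g : Field.absoluteGaloisGroup K, ρ₀.charpoly g = σ.charpoly g * ν.charpoly g) →
          σ.IsResidualRepOf (RingHom.id _) τ → IsAbsIrreducible τ → IsDecomposedGeneric τ →
          IsAbsIrreducible (τ.comp (absGaloisGroupAdjoinRootsOfUnity K ℓ₀).subtype) →
          Subgroup.IsEnormous ((absGaloisGroupAdjoinRootsOfUnity K ℓ₀).map τ) →
          (∃ s : Field.absoluteGaloisGroup K, s ∉ absGaloisGroupAdjoinRootsOfUnity K ℓ₀ ∧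
              ∃ c : padicAlgClResidueField ℓ₀, (τ s).1 = c • 1) →
          ∃ (F' : Type) (_ : Field F') (_ : NumberField F') (_ : Algebra K F') (_ : IsGalois K F'),
            NumberField.IsCMField F' ∧ (σ.restrictField F').toGaloisRep.IsIrreducible ∧
            ∀ (E : Type) [Field E] [NumberField E] [Algebra K E] [Algebra E F'] [IsScalarTower K E F'],
              IsSolvable (F' ≃ₐ[E] F') →
                ∃ (hE : isCompact_glFiniteIntegralLevel k E) (P : CuspidalAutomorphicRepData k E hE),
                  ∀ᶠ w : IsDedekindDomain.HeightOneSpectrum (NumberField.RingOfIntegers E) in cofinite,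
                    SatakeFrobCompatibleAt ι₀ P.1 (σ.restrictField E) w

/-- Card C, FIRST LEMMA: `X` + the rank-2 tiling dial ⇒ summands strongly potentially automorphic
on weight zero (no ordinary prime).  Feeds `OrdinaryPrimeTransport.RankinSelbergPoleCountR` /
`PrimeRankTransport` for the irreducibility clause of (A) at `p = 3` outright, at `p ≥ 5` for
tileable summand weights. -/
theorem stub_summandsPA (hX : WeightZeroNonOrdinaryPA)
    (hA : ∀ g : ℕ, 0 < g → PotentialAutomorphyAPWeight g) : SummandsPAWeightZero := by
  sorry

/-! ## Costume test (L3 of Cruxes/SectorComplement/NOTES.md): none of the new statements gives the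
junction by `fun h _ => …`; recorded as the shape of the intended composition only. -/

/-- The junction BY NAME from: the sector upgraded to automorphy over `K` + everything else
(`Rest`, an honest open conjunct = the PrimeSwitchSplit leaves off the sector).  Pure logic once
`Rest` is typed; here only the shape. -/
theorem shape_of_line (Rest : Prop)
    (glue : AutomorphyOnWeightZeroSector → Rest → _root_.Langlands)
    (hAut : AutomorphyOnWeightZeroSector) (hRest : Rest) : SectorComplement :=
  fun _ => glue hAut hRest

end Summit.Langlands.Langlands.Cruxes.SectorComplement.Ideas17964
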